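import Summits.QuantumFields.BalabanUV.Beta.FP.HorizontalRemainderTotal
import Summits.QuantumFields.BalabanUV.Beta.FP.HorizontalBookkeepingPaired
import Summits.QuantumFields.BalabanUV.Beta.FP.HorizontalBookkeepingDefectAveraged
import Summits.QuantumFields.BalabanUV.Beta.FP.PerfectColumnTransportTail

/-!
# `BalabanUV.Beta.FP.HorizontalRemainderPerfect` — road «FP» for binder row D1, row **GAMMA-8** (owner END, organisation γ):
# THE γ-END OF RECORD WITH ITS TRANSPORT SIDE DISCHARGED — (a) and the truncated-transport defect `E₀` are PROVED for the
# road's own transport (the perfect minimiser columns `colOf (KPerf Lc (sfStep Lc) (smStep 3 Lc) m)`, every `m ≥ 1`, m-UNIFORMLY),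
# so that `hbook` ∕ `hasym` at the perfect columns are BY TYPE functions of exactly: three letters of the transported kernel `K`
# (sextic decay, evenness, the Ward ∕ (T0) letter `HasSum (K c e) 0`), the ONE remainder letter (rem) (or its pointwise form (pp)),
# and — for `hasym` — the windowed germ letter `hgerm`

HONEST DEPENDENCY (page 1, mandatory): continuum YM on T⁴ ⇐ BetaPertH ∧ nine spine estimates (0/9 proved); BetaPertH ⇐ (D1) ∧ (D4) ∧
CAP+tail; G-an2-4 gates asym, D1 and NE2/3/4.  HONEST FRAMING (cell contract, verbatim): «discharging `BetaPertH` makes Bałaban's UV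
stability UNCONDITIONAL — a real constructive-QFT result; it is NOT the continuum limit and NOT the Clay problem.»  THIS MODULE is [folklore]
composition BY NAME of tree theorems: the γ-END `FP/HorizontalRemainderTotal.abs_secondMoment_sub_window_le_of_remainder` (owner, gen 7), its (a)-socket
`FP/HorizontalTailAssembly.hasSum_truncatedTransport` (leaf-05-g8 over leaf-02-g5's `HorizontalBookkeeping.hasSum_coarse_secondMoment_truncK`), the defect
size in the exp-ℓ¹ currency `FP/HorizontalBookkeepingDefectAveraged.pow_six_mul_abs_t0Defect_le_of_expL1` + `absMoment₂_of_expL1` (leaf-02), the Ward input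
`FP/TruncatedZerothMoment.abs_tsum_truncK_le_of_hasSum_zero` (leaf-05-g8), the (pp→rem) glue `FP/HorizontalBookkeepingPaired.rem_of_pp` (leaf-05-g12), and
THE ROAD's TRANSPORT LETTERS `FP/PerfectColumnTransportTail.transportLetters_perfCol` (gan24-p3 lineage: exact coset sums, (L1∞), `AbsMoment₂`, exp-weighted
ℓ¹ mass `≤ c∕N` for the perfect columns, ONE `(δ, c)` for all `m ≥ 1`).  No `def`, no `def … : Prop`, nothing cited, 0 sorry.
WHAT IT DISCHARGES: the hypotheses `ha` ∕ `hE₀` of the γ-END for `w :=` the perfect minimiser columns — an [our object]-level statement about the road's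
own transport, m-uniform.  WHAT IT DOES NOT: the kernel letters of `K = PiBF` (row H2-ASM-5), (rem)∕(pp) (rows GAMMA-5∕6, RHOA-6c′∕6e, RHOA-7, (GH-a),
GAMMA-7, RHOA-4c), `hgerm` (H2-ASM-5), the identification of `T m` with the one-shot coarse kernel at the perfect (j,m) objects (KER, shared lane), X1.
NOT hbook-discharged, NOT hasym, NOT D1, NOT BetaPertH, NOT continuum, NOT Clay.

ABSOLUTE RULE (cell charter, verbatim): «No internally-minted statement may enter as a cited fact. Every hypothesis is either kernel-proved in this
package or a verbatim quotation of a PUBLISHED theorem with page reference. The manuscript(s) under audit are NOT citable for their own disputed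
steps — they are the thing under adjudication; programme-internal (2001/route/tribunal) claims are never citable.»

CONTENT.
* §1 (generic, one blocking `N ≥ 1`, transport in the exp-ℓ¹ currency): **`hasSum_truncatedTransport_of_expL1`** — (a) `HasSum (Xtr·v_μ·v_ν) (g N + E₀)` AND
  `|E₀| ≤ U₀ᴱ(C,c,δ) := 16·(40C)·(2·(2ce^δ∕δ²) + 2·(ce^δ∕δ)²)` (N-FREE), `Xtr v := N⁸·dressedEntry w (truncK K N) (N•v) μ ν`, `g N := Σ_{0<‖z‖∞≤N} K μ ν z·z_μ·z_ν`,
  `E₀ := N⁶·t0Defect N w (truncK K N) Cw μ ν μ ν`; **`end_of_remainder_expL1`** ∕ **`end_of_pp_expL1`** — the γ-END with (a) discharged: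
  `Summable (T μ ν·v_μ·v_ν) ∧ |secondMoment T μ ν − g N| ≤ U₀ᴱ + Bρ` from (rem) (resp. `… ≤ U₀ᴱ + B·(1 + 9600e^{δ′∕2}(2∕δ′)⁶)` from (pp)).
* §2 (THE PERFECT COLUMNS, `d = 3`, `2 ≤ Lc`, every `m ≥ 1`): **`hbook_perfect_of_remainder`** — `∃ U₀ ≥ 0` (m-FREE) with
  `|secondMoment (T m) μ ν − g (Lc^m)| ≤ U₀ + Bρ` for all `m ≥ 1`, from the three `K`-letters and the m-uniform (rem) letter at the perfect columns;
  **`hasym_perfect_of_remainder`** — adding `hgerm`: `|secondMoment (T m) μ ν − m·(s·log Lc)| ≤ (U₀ + Bρ) + Cg + |c₀|`; **`hbook_perfect_of_pp`** ∕ **`hasym_perfect_of_pp`**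
  — the same from the pointwise paired letter (pp).
Provenance: road FP OWNER b2b-balaban-beta-d1-p3 gen 8 (prover-b2b-balaban-beta-d1-p3-g8-0), 2026-08-21, row GAMMA-8; «not in print; our bookkeeping».
-/

noncomputable section

namespace Summit.QuantumFields.BalabanUV.Beta.FP.HorizontalRemainderPerfect

open Finset Filter Topology
open Literature.Probability.LatticeModels (box annulus)
open Literature.MathematicalPhysics.QuantumFieldTheory.Balaban1983to89
open Literature.MathematicalPhysics.QuantumFieldTheory.Balaban1983to89.Beta
open B12Sec2to5 (l1)
open DyadicShell (Pt supNorm)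
open DecimatedMomentSummable (ConstReproSum LinReproSum AbsMoment₂)
open DressedMomentNormalisation (EKer dressedEntry)
open Summit.QuantumFields.BalabanUV.Beta.GAN24.CombesThomas (sfStep smStep)
open Summit.QuantumFields.BalabanUV.Beta.FP.PerfectObjectsT (KPerf)
open Summit.QuantumFields.BalabanUV.Beta.FP.TransportInfinityM (colOf)
open Summit.QuantumFields.BalabanUV.Beta.FP.HorizontalBookkeeping (truncK t0Defect)
open Summit.QuantumFields.BalabanUV.Beta.FP.HorizontalBookkeepingTail (nonneg_of_decay)
open Summit.QuantumFields.BalabanUV.Beta.FP.HorizontalTailAssembly (hasSum_truncatedTransport)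
open Summit.QuantumFields.BalabanUV.Beta.FP.HorizontalBookkeepingDefectAveraged (absMoment₂_of_expL1 pow_six_mul_abs_t0Defect_le_of_expL1)
open Summit.QuantumFields.BalabanUV.Beta.FP.TruncatedZerothMoment (abs_tsum_truncK_le_of_hasSum_zero)
open Summit.QuantumFields.BalabanUV.Beta.FP.HorizontalRemainderTotal (abs_secondMoment_sub_window_le_of_remainder)
open Summit.QuantumFields.BalabanUV.Beta.FP.HorizontalBookkeepingPaired (rem_of_pp)
open Summit.QuantumFields.BalabanUV.Beta.FP.HorizontalEndNat (hasym_of_horizontal_nat)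
open Summit.QuantumFields.BalabanUV.Beta.FP.PerfectColumnTransportTail (transportLetters_perfCol)

/-! ## §1 (a) and its defect from the exp-ℓ¹ transport letters and three kernel letters; the γ-END with (a) discharged -/

/-- [folklore] **(a) + `|E₀| ≤ U₀ᴱ`, GENERIC**: Kronecker coset sums (L0∞), (L1∞) constants `Cw`, the exp-weighted ℓ¹ transport mass
`Σ'_x e^{(δ/N)|x|₁}|w κ l x| ≤ c/N`, and three kernel letters (sextic decay, evenness, `HasSum (K c e) 0`) give the truncated transport's TOTAL
coarse second moment `HasSum (Xtr·v_μ·v_ν) (g N + E₀)` with the DISPLAYED N-free bound on the defect `E₀ = N⁶·t0Defect …`. -/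
theorem hasSum_truncatedTransport_of_expL1 {K w : EKer 4} {C c δ : ℝ} {N : ℕ} (hN : 1 ≤ N) (hδ : 0 < δ)
    (hK : ∀ c' e (t : Pt), |K c' e t| ≤ C / ((supNorm t : ℝ) + 1) ^ 6)
    (heven : ∀ c' e (t : Pt), K c' e (-t) = K c' e t)
    (hK0 : ∀ c' e, HasSum (K c' e) 0)
    (Cw : Fin 4 → Fin 4 → Fin 4 → ℝ)
    (hw0 : ∀ κ l, ConstReproSum N (w κ l) (if κ = l then (((N : ℝ) ^ (4 + 1))⁻¹) else 0))
    (hw1 : ∀ κ l, LinReproSum N (w κ l) (Cw κ l))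
    (hwE : ∀ κ l, Summable fun x => Real.exp (δ / N * l1 x) * |w κ l x|)
    (hwEb : ∀ κ l, ∑' x, Real.exp (δ / N * l1 x) * |w κ l x| ≤ c / N) (μ ν : Fin 4) :
    HasSum (fun v : Pt => ((N : ℝ) ^ 8 * dressedEntry w (truncK K N) ((N : ℤ) • v) μ ν) * (v μ : ℝ) * (v ν : ℝ))
        ((∑ z ∈ annulus 4 0 N, K μ ν z * (z μ : ℝ) * (z ν : ℝ)) + (N : ℝ) ^ 6 * t0Defect N w (truncK K N) Cw μ ν μ ν)
      ∧ |(N : ℝ) ^ 6 * t0Defect N w (truncK K N) Cw μ ν μ ν|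
          ≤ 16 * (40 * C) * (2 * (2 * c * Real.exp δ / δ ^ 2) + 2 * (c * Real.exp δ / δ) * (c * Real.exp δ / δ)) := by
  have hC : 0 ≤ C := nonneg_of_decay hK μ ν
  have hwA : ∀ κ l, AbsMoment₂ (w κ l) := fun κ l => absMoment₂_of_expL1 hδ hN (hwE κ l) (hwEb κ l)
  have hA : ∀ c' e, |∑' t : Pt, truncK K N c' e t| ≤ 40 * C / (N : ℝ) ^ 2 :=
    fun c' e => abs_tsum_truncK_le_of_hasSum_zero hC c' e (hK c' e) (hK0 c' e) hN
  refine ⟨hasSum_truncatedTransport hN w K Cw hw0 hw1 hwA heven μ ν, ?_⟩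
  rw [abs_mul, abs_of_nonneg (by positivity)]
  exact pow_six_mul_abs_t0Defect_le_of_expL1 hN hδ hw1 hwE hwEb hA μ ν μ ν

/-- [folklore] **THE γ-END WITH (a) DISCHARGED, (rem) CURRENCY**: under the letters of `hasSum_truncatedTransport_of_expL1` and the ONE remainder letter
`∀ S, Σ_{v∈S} ‖v‖∞²·|T μ ν v − Xtr v| ≤ Bρ` (`Xtr` the truncated transport of `K` by `w` at blocking `N`):
`Summable (T μ ν·v_μ·v_ν)` and `|secondMoment T μ ν − g N| ≤ U₀ᴱ + Bρ` — `HorizontalRemainderTotal.abs_secondMoment_sub_window_le_of_remainder` BY NAME. -/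
theorem end_of_remainder_expL1 {K w : EKer 4} {C c δ : ℝ} {N : ℕ} (hN : 1 ≤ N) (hδ : 0 < δ)
    (hK : ∀ c' e (t : Pt), |K c' e t| ≤ C / ((supNorm t : ℝ) + 1) ^ 6)
    (heven : ∀ c' e (t : Pt), K c' e (-t) = K c' e t)
    (hK0 : ∀ c' e, HasSum (K c' e) 0)
    (Cw : Fin 4 → Fin 4 → Fin 4 → ℝ)
    (hw0 : ∀ κ l, ConstReproSum N (w κ l) (if κ = l then (((N : ℝ) ^ (4 + 1))⁻¹) else 0))
    (hw1 : ∀ κ l, LinReproSum N (w κ l) (Cw κ l))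
    (hwE : ∀ κ l, Summable fun x => Real.exp (δ / N * l1 x) * |w κ l x|)
    (hwEb : ∀ κ l, ∑' x, Real.exp (δ / N * l1 x) * |w κ l x| ≤ c / N) (μ ν : Fin 4)
    {T : Fin 4 → Fin 4 → Pt → ℝ} {Bρ : ℝ}
    (hrem : ∀ S : Finset Pt, ∑ v ∈ S, (supNorm v : ℝ) ^ 2 *
      |T μ ν v - (N : ℝ) ^ 8 * dressedEntry w (truncK K N) ((N : ℤ) • v) μ ν| ≤ Bρ) :
    Summable (fun v : Pt => T μ ν v * (v μ : ℝ) * (v ν : ℝ)) ∧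
      |B12Beta.secondMoment T μ ν - ∑ z ∈ annulus 4 0 N, K μ ν z * (z μ : ℝ) * (z ν : ℝ)|
        ≤ 16 * (40 * C) * (2 * (2 * c * Real.exp δ / δ ^ 2) + 2 * (c * Real.exp δ / δ) * (c * Real.exp δ / δ)) + Bρ := by
  obtain ⟨ha, hE⟩ := hasSum_truncatedTransport_of_expL1 hN hδ hK heven hK0 Cw hw0 hw1 hwE hwEb μ ν
  exact abs_secondMoment_sub_window_le_of_remainder
    (Xtr := fun v : Pt => (N : ℝ) ^ 8 * dressedEntry w (truncK K N) ((N : ℤ) • v) μ ν) ha hE hrem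

/-- [folklore] **THE γ-END WITH (a) DISCHARGED, (pp) CURRENCY**: as `end_of_remainder_expL1` with the remainder letter replaced by the pointwise paired
letter `|T μ ν v − Xtr v| ≤ B·e^{−δ′‖v‖∞}` (`0 < δ′`, `0 ≤ B`): `|secondMoment T μ ν − g N| ≤ U₀ᴱ + B·(1 + 9600·e^{δ′/2}·(2/δ′)⁶)` —
`HorizontalBookkeepingPaired.rem_of_pp` BY NAME. -/
theorem end_of_pp_expL1 {K w : EKer 4} {C c δ : ℝ} {N : ℕ} (hN : 1 ≤ N) (hδ : 0 < δ)
    (hK : ∀ c' e (t : Pt), |K c' e t| ≤ C / ((supNorm t : ℝ) + 1) ^ 6)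
    (heven : ∀ c' e (t : Pt), K c' e (-t) = K c' e t)
    (hK0 : ∀ c' e, HasSum (K c' e) 0)
    (Cw : Fin 4 → Fin 4 → Fin 4 → ℝ)
    (hw0 : ∀ κ l, ConstReproSum N (w κ l) (if κ = l then (((N : ℝ) ^ (4 + 1))⁻¹) else 0))
    (hw1 : ∀ κ l, LinReproSum N (w κ l) (Cw κ l))
    (hwE : ∀ κ l, Summable fun x => Real.exp (δ / N * l1 x) * |w κ l x|)
    (hwEb : ∀ κ l, ∑' x, Real.exp (δ / N * l1 x) * |w κ l x| ≤ c / N) (μ ν : Fin 4)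
    {T : Fin 4 → Fin 4 → Pt → ℝ} {B δ' : ℝ} (hδ' : 0 < δ') (hB : 0 ≤ B)
    (hpp : ∀ v : Pt, |T μ ν v - (N : ℝ) ^ 8 * dressedEntry w (truncK K N) ((N : ℤ) • v) μ ν|
      ≤ B * Real.exp (-δ' * (supNorm v : ℝ))) :
    Summable (fun v : Pt => T μ ν v * (v μ : ℝ) * (v ν : ℝ)) ∧
      |B12Beta.secondMoment T μ ν - ∑ z ∈ annulus 4 0 N, K μ ν z * (z μ : ℝ) * (z ν : ℝ)|
        ≤ 16 * (40 * C) * (2 * (2 * c * Real.exp δ / δ ^ 2) + 2 * (c * Real.exp δ / δ) * (c * Real.exp δ / δ))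
          + B * (1 + 9600 * Real.exp (δ' / 2) * (2 / δ') ^ 6) :=
  end_of_remainder_expL1 hN hδ hK heven hK0 Cw hw0 hw1 hwE hwEb μ ν
    (rem_of_pp (T := T) (Xtr := fun v : Pt => (N : ℝ) ^ 8 * dressedEntry w (truncK K N) ((N : ℤ) • v) μ ν) hδ' hB hpp)

/-! ## §2 The perfect minimiser columns: `hbook` and `hasym` at the road's own transport, m-uniformly -/

section Perfect

variable {Lc : ℕ} [NeZero Lc]

/-- **`hbook` AT THE PERFECT COLUMNS FROM THREE KERNEL LETTERS AND THE REMAINDER LETTER** [our object] (`d = 3`, `2 ≤ Lc`): for a transported kernel `K`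
with sextic decay, evenness and `HasSum (K c e) 0`, and ANY family `T m` of coarse kernels (`m ≥ 1`) whose remainder against the truncated transport of `K`
by the PERFECT minimiser columns `colOf (KPerf Lc (sfStep Lc) (smStep 3 Lc) m)` at blocking `Lc^m` obeys the m-UNIFORM letter (rem) with constant `Bρ`,
there is an m-FREE `U₀ ≥ 0` with `|secondMoment (T m) μ ν − Σ_{0<‖z‖∞≤Lc^m} K μ ν z·z_μ·z_ν| ≤ U₀ + Bρ` for every `m ≥ 1`.  The transport side is the
tree theorem `PerfectColumnTransportTail.transportLetters_perfCol`; nothing about the transport is a hypothesis. -/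
theorem hbook_perfect_of_remainder (hLc : 2 ≤ Lc) {K : EKer 4} {C : ℝ}
    (hK : ∀ c' e (t : Pt), |K c' e t| ≤ C / ((supNorm t : ℝ) + 1) ^ 6)
    (heven : ∀ c' e (t : Pt), K c' e (-t) = K c' e t) (hK0 : ∀ c' e, HasSum (K c' e) 0)
    {T : ℕ → Fin 4 → Fin 4 → Pt → ℝ} (μ ν : Fin 4) {Bρ : ℝ}
    (hrem : ∀ m : ℕ, 1 ≤ m → ∀ S : Finset Pt, ∑ v ∈ S, (supNorm v : ℝ) ^ 2 *
      |T m μ ν v - ((Lc ^ m : ℕ) : ℝ) ^ 8 * dressedEntry (colOf (KPerf (d := 3) Lc (sfStep Lc) (smStep 3 Lc) m))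
          (truncK K (Lc ^ m)) (((Lc ^ m : ℕ) : ℤ) • v) μ ν| ≤ Bρ) :
    ∃ U₀ : ℝ, 0 ≤ U₀ ∧ ∀ m : ℕ, 1 ≤ m →
      (Summable fun v : Pt => T m μ ν v * (v μ : ℝ) * (v ν : ℝ)) ∧
      |B12Beta.secondMoment (T m) μ ν - ∑ z ∈ annulus 4 0 (Lc ^ m), K μ ν z * (z μ : ℝ) * (z ν : ℝ)| ≤ U₀ + Bρ := by
  obtain ⟨δ, c, hδ, hc, hL⟩ := transportLetters_perfCol (Lc := Lc) hLc
  have hC : 0 ≤ C := nonneg_of_decay hK μ ν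
  refine ⟨16 * (40 * C) * (2 * (2 * c * Real.exp δ / δ ^ 2) + 2 * (c * Real.exp δ / δ) * (c * Real.exp δ / δ)),
    by positivity, fun m hm => ?_⟩
  obtain ⟨hw0, ⟨Cw, hw1⟩, -, hwE, hwEb⟩ := hL m hm
  have hN : 1 ≤ Lc ^ m := Nat.one_le_pow m Lc (Nat.pos_of_ne_zero (NeZero.ne Lc))
  exact end_of_remainder_expL1 hN hδ hK heven hK0 Cw hw0 hw1 hwE hwEb μ ν (hrem m hm)

/-- **`hasym` AT THE PERFECT COLUMNS** [our object] (`d = 3`, `2 ≤ Lc`): `hbook_perfect_of_remainder` plus the windowed germ letter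
`hgerm : ∀ M ≥ 1, |Σ_{0<‖z‖∞≤M} K μ ν z·z_μ·z_ν − (s·log M + c₀)| ≤ Cg` give an m-FREE `U₀ ≥ 0` with
`|secondMoment (T m) μ ν − m·(s·log Lc)| ≤ (U₀ + Bρ) + Cg + |c₀|` for every `m ≥ 1` (`HorizontalEndNat.hasym_of_horizontal_nat` BY NAME) —
the (ASYMP) hypothesis of `FixedPointIdentification` ∕ `PerfectObjectsT.d1Drift_JsBalOf_of_perfect_step_law_bounded` in its bounded form, for `f m := secondMoment (T m) μ ν`. -/
theorem hasym_perfect_of_remainder (hLc : 2 ≤ Lc) {K : EKer 4} {C : ℝ}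
    (hK : ∀ c' e (t : Pt), |K c' e t| ≤ C / ((supNorm t : ℝ) + 1) ^ 6)
    (heven : ∀ c' e (t : Pt), K c' e (-t) = K c' e t) (hK0 : ∀ c' e, HasSum (K c' e) 0)
    {T : ℕ → Fin 4 → Fin 4 → Pt → ℝ} (μ ν : Fin 4) {Bρ : ℝ}
    (hrem : ∀ m : ℕ, 1 ≤ m → ∀ S : Finset Pt, ∑ v ∈ S, (supNorm v : ℝ) ^ 2 *
      |T m μ ν v - ((Lc ^ m : ℕ) : ℝ) ^ 8 * dressedEntry (colOf (KPerf (d := 3) Lc (sfStep Lc) (smStep 3 Lc) m))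
          (truncK K (Lc ^ m)) (((Lc ^ m : ℕ) : ℤ) • v) μ ν| ≤ Bρ)
    {s c₀ Cg : ℝ}
    (hgerm : ∀ M : ℕ, 1 ≤ M → |∑ z ∈ annulus 4 0 M, K μ ν z * (z μ : ℝ) * (z ν : ℝ) - (s * Real.log M + c₀)| ≤ Cg) :
    ∃ U₀ : ℝ, 0 ≤ U₀ ∧ ∀ m : ℕ, 1 ≤ m →
      |B12Beta.secondMoment (T m) μ ν - (m : ℝ) * (s * Real.log Lc)| ≤ (U₀ + Bρ) + Cg + |c₀| := by
  obtain ⟨U₀, hU₀, hbook⟩ := hbook_perfect_of_remainder hLc hK heven hK0 (T := T) μ ν hrem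
  have hLc1 : 1 ≤ Lc := le_trans (by norm_num) hLc
  exact ⟨U₀, hU₀, hasym_of_horizontal_nat (f := fun m => B12Beta.secondMoment (T m) μ ν)
    (g := fun M => ∑ z ∈ annulus 4 0 M, K μ ν z * (z μ : ℝ) * (z ν : ℝ)) hLc1 (fun m hm => (hbook m hm).2) hgerm⟩

/-- **`hbook` AT THE PERFECT COLUMNS FROM THE POINTWISE PAIRED LETTER (pp)** [our object] (`d = 3`, `2 ≤ Lc`): as `hbook_perfect_of_remainder`
with the m-uniform pointwise letter `|T m μ ν v − Xtr_m v| ≤ B·e^{−δ′‖v‖∞}` in place of (rem); constant `U₀ + B·(1 + 9600·e^{δ′/2}·(2/δ′)⁶)`. -/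
theorem hbook_perfect_of_pp (hLc : 2 ≤ Lc) {K : EKer 4} {C : ℝ}
    (hK : ∀ c' e (t : Pt), |K c' e t| ≤ C / ((supNorm t : ℝ) + 1) ^ 6)
    (heven : ∀ c' e (t : Pt), K c' e (-t) = K c' e t) (hK0 : ∀ c' e, HasSum (K c' e) 0)
    {T : ℕ → Fin 4 → Fin 4 → Pt → ℝ} (μ ν : Fin 4) {B δ' : ℝ} (hδ' : 0 < δ') (hB : 0 ≤ B)
    (hpp : ∀ m : ℕ, 1 ≤ m → ∀ v : Pt,
      |T m μ ν v - ((Lc ^ m : ℕ) : ℝ) ^ 8 * dressedEntry (colOf (KPerf (d := 3) Lc (sfStep Lc) (smStep 3 Lc) m))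
          (truncK K (Lc ^ m)) (((Lc ^ m : ℕ) : ℤ) • v) μ ν| ≤ B * Real.exp (-δ' * (supNorm v : ℝ))) :
    ∃ U₀ : ℝ, 0 ≤ U₀ ∧ ∀ m : ℕ, 1 ≤ m →
      (Summable fun v : Pt => T m μ ν v * (v μ : ℝ) * (v ν : ℝ)) ∧
      |B12Beta.secondMoment (T m) μ ν - ∑ z ∈ annulus 4 0 (Lc ^ m), K μ ν z * (z μ : ℝ) * (z ν : ℝ)|
        ≤ U₀ + B * (1 + 9600 * Real.exp (δ' / 2) * (2 / δ') ^ 6) :=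
  hbook_perfect_of_remainder hLc hK heven hK0 (T := T) μ ν fun m hm =>
    rem_of_pp (T := T m) (Xtr := fun v : Pt => ((Lc ^ m : ℕ) : ℝ) ^ 8 *
      dressedEntry (colOf (KPerf (d := 3) Lc (sfStep Lc) (smStep 3 Lc) m)) (truncK K (Lc ^ m)) (((Lc ^ m : ℕ) : ℤ) • v) μ ν)
      hδ' hB (hpp m hm)

/-- **`hasym` AT THE PERFECT COLUMNS FROM (pp) + `hgerm`** [our object] (`d = 3`, `2 ≤ Lc`): `∃ U₀ ≥ 0`, m-free, with
`|secondMoment (T m) μ ν − m·(s·log Lc)| ≤ (U₀ + B·(1 + 9600·e^{δ′/2}·(2/δ′)⁶)) + Cg + |c₀|` for every `m ≥ 1`. -/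
theorem hasym_perfect_of_pp (hLc : 2 ≤ Lc) {K : EKer 4} {C : ℝ}
    (hK : ∀ c' e (t : Pt), |K c' e t| ≤ C / ((supNorm t : ℝ) + 1) ^ 6)
    (heven : ∀ c' e (t : Pt), K c' e (-t) = K c' e t) (hK0 : ∀ c' e, HasSum (K c' e) 0)
    {T : ℕ → Fin 4 → Fin 4 → Pt → ℝ} (μ ν : Fin 4) {B δ' : ℝ} (hδ' : 0 < δ') (hB : 0 ≤ B)
    (hpp : ∀ m : ℕ, 1 ≤ m → ∀ v : Pt,
      |T m μ ν v - ((Lc ^ m : ℕ) : ℝ) ^ 8 * dressedEntry (colOf (KPerf (d := 3) Lc (sfStep Lc) (smStep 3 Lc) m))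
          (truncK K (Lc ^ m)) (((Lc ^ m : ℕ) : ℤ) • v) μ ν| ≤ B * Real.exp (-δ' * (supNorm v : ℝ)))
    {s c₀ Cg : ℝ}
    (hgerm : ∀ M : ℕ, 1 ≤ M → |∑ z ∈ annulus 4 0 M, K μ ν z * (z μ : ℝ) * (z ν : ℝ) - (s * Real.log M + c₀)| ≤ Cg) :
    ∃ U₀ : ℝ, 0 ≤ U₀ ∧ ∀ m : ℕ, 1 ≤ m →
      |B12Beta.secondMoment (T m) μ ν - (m : ℝ) * (s * Real.log Lc)|
        ≤ (U₀ + B * (1 + 9600 * Real.exp (δ' / 2) * (2 / δ') ^ 6)) + Cg + |c₀| := by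
  obtain ⟨U₀, hU₀, hbook⟩ := hbook_perfect_of_pp hLc hK heven hK0 (T := T) μ ν hδ' hB hpp
  have hLc1 : 1 ≤ Lc := le_trans (by norm_num) hLc
  exact ⟨U₀, hU₀, hasym_of_horizontal_nat (f := fun m => B12Beta.secondMoment (T m) μ ν)
    (g := fun M => ∑ z ∈ annulus 4 0 M, K μ ν z * (z μ : ℝ) * (z ν : ℝ)) hLc1 (fun m hm => (hbook m hm).2) hgerm⟩

end Perfect

end Summit.QuantumFields.BalabanUV.Beta.FP.HorizontalRemainderPerfect

end
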